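import Summits.QuantumFields.YangMills.Theorems.UnitScaleGibbsTestFieldSU2DressingFlatPairing
import Summits.QuantumFields.YangMills.Theorems.UnitScaleGibbsChartPairingDictionary
import Summits.QuantumFields.YangMills.Theorems.CovariantDischargeTruncatedPotentialPairing
import HarnessLib

/-!
# `GrossTransferStubLinTestSDTerm` — KNIT-E5: THE SCHWINGER–DYSON TERM OF THE KNIT-E2 SKELETON's (P4) IDENTITY, ONE REAL INEQUALITY IN THE PEN's LETTERS
# `|actionDeriv ρ (u α) V + ¼·Σ_{Q_{3R+2}(z₀)}Σ_μΣ_ν daR·F̂^α| ≤ 14·((d−1)nθ)·θ·4(d−1)·Σ_{Q_{3R}(z₀)}Σ_ν |ã|`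
# (LINE 28 «GrossTransfer», `stub_linTest` v3.2 = 23083 skeleton of record; crux `UnitScaleTilt.HistoryTailL` stmt-QuantumFields-19936)

Cell `ym3-torus` (YM ladder rung R3 = continuum SU(2) Yang–Mills on every three-torus — a RUNG, NOT d = 4, NOT infinite volume, NOT a mass gap, NOT the
Clay problem); width seat `ym-ust-19936-w5` gen 17, on the pen of record's KNIT-PLAN v3 (★w2-19936 g15, 23083 evidence #19, recipe (P5) and the NORM-SCOPE
rule: «P5∕P6∕P7 as separate files exporting REAL inequalities in instance-free letters; the Frobenius-scoped package only combines»).  In the pen's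
`main_estimate` the block-plaquette proxy has been reduced (P3, P4 ✓) to `ℤ³` pairings against the antisymmetrised Pauli read-out
`F̂^α(y,μ,ν) = Re tr((iσ_α)(V(∂⟨castSite y,μ,ν⟩) − 1))` (`μ<ν`; `V = U^{axialGauge U lo hi}`); the SD piece is `Σ_{y∈Q_{3R+2}(z₀)}Σ_μΣ_ν daR·F̂^α` with
`daR` the `ℤ³` curl of the truncated potential `aR = χ·ã` whose push `u0` (✓`exists_push`) dresses to the stub's test field `u α b = (u0 b : ℂ) • (iσ_α)`.
THIS FILE (no matrix-norm scope opened; every exported statement is a real inequality ∕ identity):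
* `margin_of_cutoff` — the margin row `aR x μ ≠ 0 → lo + 1 ≤ x ∧ x + e_μ + 1 ≤ hi` FROM the pen's letters (`aR = χ·ã`, `χ = 0` off `Q_{3R}(z₀)`,
  `lo = z₀ − (3R+2)`, `hi = z₀ + (3R+4)`); `daR_antisymm`; `daR_eq_zero_of_not_mem` (`daR = 0` off `Q_{3R+1}(z₀)`); `box_subset_piFinset`;
* ★★`sum_curl_push_mul_eq_quarter` — THE PAIRING IN THE PEN's LETTERS: `Σ_p (du0)_p·F^α_p = ½·Σ_{y∈Q_{3R+2}(z₀)}Σ_μΣ_ν daR y μ ν·F̂^α y μ ν`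
  (✓DRESS-2 `sum_curl_push_mul_eq_sum_box` + ✓E2a `sum_sum_eq_two_mul_sum_lt` + `Finset.sum_subset` from `Π[lo,hi]` down to `Q_{3R+2}`);
* ★`sum_abs_push_le_sum_abs_potential` — `Σ_b |u0 b| ≤ Σ_{y∈Q_{3R}(z₀)}Σ_ν |ã y ν|` (✓DRESS-3 `sum_abs_push_eq_sum_box` + ✓(Z-e) `sum_abs_truncated_le`);
* ★★★`sd_term_le` — the display above (✓DRESS-3 `abs_actionDeriv_dress_add_half_fluxPairing_le_norm1` + the two rows); the pen closes the error with
  ✓(Z-c′) `near_mass_le (S := 3R) (ℓ := ℓ0)` (`Σ|ã| ≤ (9∕2)(K₀ + 26C₁(3R+1+ℓ0))·M₀`) and `M₀ ≤ 2(L·L)^j` (✓M0-ROWS).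
HONEST SCOPE.  Bookkeeping over landed rows; proves no stub and closes no item.  Nothing of `main_estimate`, `stub_linTest`, «ShallowFluxSecondMomentL», (Q),
23083∕23133∕23134, K1, `stub_pinnedStep`∕`stub_unitEnvelope` or `HistoryTailL` is proved.  YM₃ on T³ is rung R3 — NOT d = 4, NOT a mass gap, NOT Clay.
References: L. Gross, CMP **92** (1983) 137–162, Thm 2.2 [GrossCMP1983]; T. Bałaban, CMP **99** (1985) 389–434, (3.7) p. 391, (3.100) p. 413
[Balaban1985BackgroundPropagators]; CMP **96** (1984) 223–250, (1.9) p. 226 [Balaban1984PropagatorsII].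
-/

set_option autoImplicit false

noncomputable section

open scoped BigOperators Matrix
open Complex Finset
open Literature.MathematicalPhysics.QuantumFieldTheory.Balaban1983to89
open Literature.MathematicalPhysics.QuantumFieldTheory.Balaban1983to89.B4Eq19LatticeOperators (Zd unitVec box mem_box abs_unitVec_apply_le)
open Literature.MathematicalPhysics.QuantumFieldTheory.Balaban1983to89.T4AxialGaugeSmallField (castSite boxPlaqs boxBonds axialGauge)
open Literature.MathematicalPhysics.QuantumFieldTheory.Balaban1983to89.B7Prop1Explicit (e)
open Literature.MathematicalPhysics.QuantumFieldTheory.Balaban1983to89.B10Eq18SigmaSU2 (pauli)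
open Literature.MathematicalPhysics.QuantumLattice (fundamentalRep)
open Summit.QuantumFields.YangMills.Theorems.UnitScaleGibbsActionDerivativeSlotCalculus (slotBond actionDeriv)
open Summit.QuantumFields.YangMills.Theorems.UnitScaleGibbsTemporalGaugePrimitiveTorus (e_eq_unitVec)
open Summit.QuantumFields.YangMills.Theorems.UnitScaleGibbsTestFieldSU2DressingPush (push_support_margin_of_margin1 sum_curl_push_mul_eq_sum_box
  mem_piFinset_Icc_iff)
open Summit.QuantumFields.YangMills.Theorems.UnitScaleGibbsTestFieldSU2DressingFlatPairing (abs_actionDeriv_dress_add_half_fluxPairing_le_norm1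
  sum_abs_push_eq_sum_box)
open Summit.QuantumFields.YangMills.Theorems.UnitScaleGibbsChartPairingDictionary (sum_sum_eq_two_mul_sum_lt)
open Summit.QuantumFields.YangMills.Theorems.CovariantDischargeTruncatedPotentialPairing (truncated_eq_zero_off sum_abs_truncated_le)

namespace Summit.QuantumFields.YangMills.Theorems.GrossTransferStubLinTestSDTerm

variable {P : Params} {j : ℕ}

/-! ## §1 Letters: the margin row from the cutoff, antisymmetry and support of `daR`, the box inclusion -/

/-- **THE MARGIN ROW FROM THE PEN's LETTERS**: `aR = χ·ã` with `χ = 0` off `Q_{3R}(z₀)` and the dressing box `lo = z₀ − (3R+2)`, `hi = z₀ + (3R+4)` give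
`aR x μ ≠ 0 → lo + 1 ≤ x ∧ x + e_μ + 1 ≤ hi`. [cite: Balaban1984PropagatorsII, (1.9) p.226] -/
theorem margin_of_cutoff {lo hi : Fin P.d → ℤ} (z₀ : Zd P.d) (R : ℕ)
    (hlo : ∀ κ, lo κ = z₀ κ - (3 * (R : ℤ) + 2)) (hhi : ∀ κ, hi κ = z₀ κ + (3 * (R : ℤ) + 4))
    (at' : Zd P.d → Fin P.d → ℝ) (χ : Zd P.d → ℝ) (aR : Zd P.d → Fin P.d → ℝ)
    (hχ0 : ∀ x, x ∉ box z₀ (3 * (R : ℤ)) → χ x = 0) (haR : ∀ x ν, aR x ν = χ x * at' x ν) :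
    ∀ x μ, aR x μ ≠ 0 → lo + 1 ≤ x ∧ x + unitVec μ + 1 ≤ hi := by
  intro x μ hx
  have hxbox : x ∈ box z₀ (3 * (R : ℤ)) := by
    by_contra hnot
    exact hx (truncated_eq_zero_off at' χ aR hχ0 haR x hnot μ)
  rw [mem_box] at hxbox
  refine ⟨fun κ => ?_, fun κ => ?_⟩
  · have h := hxbox κ
    rw [abs_le] at h
    simp only [Pi.add_apply, Pi.one_apply, hlo κ]
    linarith
  · have h := hxbox κ
    rw [abs_le] at h
    have hu : (unitVec μ : Zd P.d) κ ≤ 1 := le_trans (le_abs_self _) (abs_unitVec_apply_le μ κ)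
    simp only [Pi.add_apply, Pi.one_apply, hhi κ]
    linarith

/-- `daR` is antisymmetric in its direction indices (from its defining row). [folklore] -/
theorem daR_antisymm (aR : Zd P.d → Fin P.d → ℝ) (daR : Zd P.d → Fin P.d → Fin P.d → ℝ)
    (hdaR : ∀ x μ ν, daR x μ ν = (aR (x + unitVec μ) ν - aR x ν) - (aR (x + unitVec ν) μ - aR x μ)) (x : Zd P.d) (μ ν : Fin P.d) :
    daR x ν μ = -daR x μ ν := by
  rw [hdaR, hdaR]; ring

/-- `aR ≠ 0` only on `Q_{3R}(z₀)`; hence `aR(y + e_κ) ≠ 0` or `aR y ≠ 0` forces `y ∈ Q_{3R+1}(z₀)`. [folklore] -/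
theorem mem_box_succ_of_ne_zero (z₀ : Zd P.d) (R : ℕ) (at' : Zd P.d → Fin P.d → ℝ) (χ : Zd P.d → ℝ) (aR : Zd P.d → Fin P.d → ℝ)
    (hχ0 : ∀ x, x ∉ box z₀ (3 * (R : ℤ)) → χ x = 0) (haR : ∀ x ν, aR x ν = χ x * at' x ν)
    {y : Zd P.d} {κ ν : Fin P.d} (h : aR (y + unitVec κ) ν ≠ 0 ∨ aR y ν ≠ 0) : y ∈ box z₀ (3 * (R : ℤ) + 1) := by
  rw [mem_box]
  intro i
  rcases h with h | h
  · have hx : y + unitVec κ ∈ box z₀ (3 * (R : ℤ)) := by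
      by_contra hnot; exact h (truncated_eq_zero_off at' χ aR hχ0 haR _ hnot ν)
    rw [mem_box] at hx
    have hi := hx i
    have hu := abs_unitVec_apply_le (d := P.d) κ i
    simp only [Pi.add_apply] at hi
    rw [abs_le] at hi hu ⊢
    constructor <;> linarith [hi.1, hi.2, hu.1, hu.2]
  · have hx : y ∈ box z₀ (3 * (R : ℤ)) := by
      by_contra hnot; exact h (truncated_eq_zero_off at' χ aR hχ0 haR _ hnot ν)
    rw [mem_box] at hx
    have hi := hx i
    rw [abs_le] at hi ⊢
    constructor <;> linarith [hi.1, hi.2]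

/-- ★ `daR` vanishes off `Q_{3R+1}(z₀)`. [folklore] -/
theorem daR_eq_zero_of_not_mem (z₀ : Zd P.d) (R : ℕ) (at' : Zd P.d → Fin P.d → ℝ) (χ : Zd P.d → ℝ) (aR : Zd P.d → Fin P.d → ℝ)
    (daR : Zd P.d → Fin P.d → Fin P.d → ℝ)
    (hχ0 : ∀ x, x ∉ box z₀ (3 * (R : ℤ)) → χ x = 0) (haR : ∀ x ν, aR x ν = χ x * at' x ν)
    (hdaR : ∀ x μ ν, daR x μ ν = (aR (x + unitVec μ) ν - aR x ν) - (aR (x + unitVec ν) μ - aR x μ))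
    {y : Zd P.d} (hy : y ∉ box z₀ (3 * (R : ℤ) + 1)) (μ ν : Fin P.d) : daR y μ ν = 0 := by
  have h1 : aR (y + unitVec μ) ν = 0 := by
    by_contra hne; exact hy (mem_box_succ_of_ne_zero z₀ R at' χ aR hχ0 haR (Or.inl hne))
  have h2 : aR y ν = 0 := by
    by_contra hne; exact hy (mem_box_succ_of_ne_zero z₀ R at' χ aR hχ0 haR (κ := μ) (Or.inr hne))
  have h3 : aR (y + unitVec ν) μ = 0 := by
    by_contra hne; exact hy (mem_box_succ_of_ne_zero z₀ R at' χ aR hχ0 haR (Or.inl hne))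
  have h4 : aR y μ = 0 := by
    by_contra hne; exact hy (mem_box_succ_of_ne_zero z₀ R at' χ aR hχ0 haR (κ := ν) (Or.inr hne))
  rw [hdaR, h1, h2, h3, h4]; ring

/-- The box `Q_{3R+2}(z₀)` sits inside the dressing box `Π[lo,hi]`, `lo = z₀ − (3R+2)`, `hi = z₀ + (3R+4)`. [folklore] -/
theorem box_subset_piFinset {lo hi : Fin P.d → ℤ} (z₀ : Zd P.d) (R : ℕ)
    (hlo : ∀ κ, lo κ = z₀ κ - (3 * (R : ℤ) + 2)) (hhi : ∀ κ, hi κ = z₀ κ + (3 * (R : ℤ) + 4)) :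
    box z₀ (3 * (R : ℤ) + 2) ⊆ Fintype.piFinset (fun i => Finset.Icc (lo i) (hi i)) := by
  intro y hy
  rw [mem_box] at hy
  rw [mem_piFinset_Icc_iff]
  refine ⟨fun i => ?_, fun i => ?_⟩
  · have h := hy i; rw [abs_le] at h; rw [hlo i]; linarith
  · have h := hy i; rw [abs_le] at h; rw [hhi i]; linarith

/-- `Q_{3R+1}(z₀) ⊆ Q_{3R+2}(z₀)`. [folklore] -/
theorem box_rad_succ_subset (z₀ : Zd P.d) (R : ℕ) : box z₀ (3 * (R : ℤ) + 1) ⊆ box z₀ (3 * (R : ℤ) + 2) := by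
  intro y hy
  rw [mem_box] at hy ⊢
  exact fun i => (hy i).trans (by linarith)

/-! ## §2 The pairing and the error in the pen's letters -/

/-- ★★ **THE SD PAIRING IN THE PEN's LETTERS**: `Σ_p (du0)_p·F^α_p = ½·Σ_{y∈Q_{3R+2}(z₀)}Σ_μΣ_ν daR y μ ν·F̂^α y μ ν` for the push `u0` of `aR` and the
antisymmetrised read-out `F̂^α` of `F^α_p = Re tr((iσ_α)(V(∂p) − 1))` (any `V`). [cite: Balaban1985BackgroundPropagators, (3.100) p.413]
[cite: GrossCMP1983, Thm 2.2] -/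
theorem sum_curl_push_mul_eq_half {lo hi : Fin P.d → ℤ} (hN : ∀ κ, hi κ - lo κ < P.sitesPerDir j) (z₀ : Zd P.d) (R : ℕ)
    (hlo : ∀ κ, lo κ = z₀ κ - (3 * (R : ℤ) + 2)) (hhi : ∀ κ, hi κ = z₀ κ + (3 * (R : ℤ) + 4))
    (at' : Zd P.d → Fin P.d → ℝ) (χ : Zd P.d → ℝ) (aR : Zd P.d → Fin P.d → ℝ) (daR : Zd P.d → Fin P.d → Fin P.d → ℝ)
    (hχ0 : ∀ x, x ∉ box z₀ (3 * (R : ℤ)) → χ x = 0) (haR : ∀ x ν, aR x ν = χ x * at' x ν)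
    (hdaR : ∀ x μ ν, daR x μ ν = (aR (x + unitVec μ) ν - aR x ν) - (aR (x + unitVec ν) μ - aR x μ))
    (u0 : PBond P j → ℝ)
    (hu0 : ∀ (x : Fin P.d → ℤ) (μ : Fin P.d), lo ≤ x → x + e μ ≤ hi → u0 ⟨castSite x, μ⟩ = aR x μ)
    (hu0off : ∀ b : PBond P j, (¬ ∃ y : Fin P.d → ℤ, lo ≤ y ∧ y + e b.dir ≤ hi ∧ b.src = castSite y) → u0 b = 0)
    (G : Plaq P j → ℝ) (Gh : Zd P.d → Fin P.d → Fin P.d → ℝ)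
    (hGh : ∀ z (μ ν : Fin P.d) (h : μ < ν), Gh z μ ν = G ⟨castSite z, μ, ν, h⟩) (hGha : ∀ z μ ν, Gh z ν μ = -Gh z μ ν) :
    ∑ p : Plaq P j, (u0 (slotBond p 0) + u0 (slotBond p 1) - u0 (slotBond p 2) - u0 (slotBond p 3)) * G p =
      (1 / 2) * ∑ y ∈ box z₀ (3 * (R : ℤ) + 2), ∑ μ : Fin P.d, ∑ ν : Fin P.d, daR y μ ν * Gh y μ ν := by
  classical
  have haR1 := margin_of_cutoff z₀ R hlo hhi at' χ aR hχ0 haR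
  rw [sum_curl_push_mul_eq_sum_box hN aR haR1 u0 hu0 hu0off G]
  -- each point: the `μ<ν` sum is half the ordered double sum (both arrays antisymmetric)
  have hpt : ∀ y : Zd P.d, ∑ q : {q : Fin P.d × Fin P.d // q.1 < q.2},
      ((aR (y + unitVec q.1.1) q.1.2 - aR y q.1.2) - (aR (y + unitVec q.1.2) q.1.1 - aR y q.1.1)) * G ⟨castSite y, q.1.1, q.1.2, q.2⟩ =
      (1 / 2) * ∑ μ : Fin P.d, ∑ ν : Fin P.d, daR y μ ν * Gh y μ ν := by
    intro y
    rw [sum_sum_eq_two_mul_sum_lt (daR y) (Gh y) (daR_antisymm aR daR hdaR y) (hGha y)]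
    rw [show (1 : ℝ) / 2 * (2 * ∑ q : {q : Fin P.d × Fin P.d // q.1 < q.2}, daR y q.1.1 q.1.2 * Gh y q.1.1 q.1.2) =
      ∑ q : {q : Fin P.d × Fin P.d // q.1 < q.2}, daR y q.1.1 q.1.2 * Gh y q.1.1 q.1.2 by ring]
    refine Finset.sum_congr rfl fun q _ => ?_
    rw [hdaR, hGh y q.1.1 q.1.2 q.2]
  rw [Finset.sum_congr rfl fun y _ => hpt y, ← Finset.mul_sum _ _ ((1 : ℝ) / 2)]
  congr 1
  -- from the dressing box down to `Q_{3R+2}`: `daR` vanishes off `Q_{3R+1} ⊆ Q_{3R+2}`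
  symm
  refine Finset.sum_subset (box_subset_piFinset z₀ R hlo hhi) fun y _ hy => ?_
  have hy' : y ∉ box z₀ (3 * (R : ℤ) + 1) := fun h => hy (Finset.mem_of_subset (box_rad_succ_subset z₀ R) h)
  exact Finset.sum_eq_zero fun μ _ => Finset.sum_eq_zero fun ν _ => by
    rw [daR_eq_zero_of_not_mem z₀ R at' χ aR daR hχ0 haR hdaR hy' μ ν, zero_mul]

/-- ★ **THE ERROR IN THE PEN's LETTERS**: `Σ_b |u0 b| ≤ Σ_{y∈Q_{3R}(z₀)}Σ_ν |ã y ν|` (push read-back + `|aR| ≤ |ã|` on `Q_{3R}`, `0` outside).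
[cite: Balaban1984PropagatorsII, (1.9) p.226] -/
theorem sum_abs_push_le_sum_abs_potential {lo hi : Fin P.d → ℤ} (hN : ∀ κ, hi κ - lo κ < P.sitesPerDir j) (z₀ : Zd P.d) (R : ℕ)
    (hlo : ∀ κ, lo κ = z₀ κ - (3 * (R : ℤ) + 2)) (hhi : ∀ κ, hi κ = z₀ κ + (3 * (R : ℤ) + 4))
    (at' : Zd P.d → Fin P.d → ℝ) (χ : Zd P.d → ℝ) (aR : Zd P.d → Fin P.d → ℝ)
    (hχ01 : ∀ x, 0 ≤ χ x ∧ χ x ≤ 1) (hχ0 : ∀ x, x ∉ box z₀ (3 * (R : ℤ)) → χ x = 0) (haR : ∀ x ν, aR x ν = χ x * at' x ν)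
    (u0 : PBond P j → ℝ)
    (hu0 : ∀ (x : Fin P.d → ℤ) (μ : Fin P.d), lo ≤ x → x + e μ ≤ hi → u0 ⟨castSite x, μ⟩ = aR x μ)
    (hu0off : ∀ b : PBond P j, (¬ ∃ y : Fin P.d → ℤ, lo ≤ y ∧ y + e b.dir ≤ hi ∧ b.src = castSite y) → u0 b = 0) :
    ∑ b : PBond P j, |u0 b| ≤ ∑ y ∈ box z₀ (3 * (R : ℤ)), ∑ ν : Fin P.d, |at' y ν| := by
  rw [sum_abs_push_eq_sum_box hN aR (margin_of_cutoff z₀ R hlo hhi at' χ aR hχ0 haR) u0 hu0 hu0off]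
  exact sum_abs_truncated_le at' χ aR z₀ (3 * (R : ℤ)) hχ01 hχ0 haR _

/-! ## §3 KNIT-E5: the SD term -/

/-- ★★★ **KNIT-E5 — THE SCHWINGER–DYSON TERM OF (P4), ONE REAL INEQUALITY.**  On the `θ`-small dressing box (`PlaqSmallOn (boxPlaqs lo hi) θ U`,
`hi ≤ lo + n`, `n < sitesPerDir`, non-wrapping), with `V := U^{axialGauge U lo hi}`, `lo = z₀ − (3R+2)`, `hi = z₀ + (3R+4)`, the truncated potential
`aR = χ·ã` (`0 ≤ χ ≤ 1`, `χ = 0` off `Q_{3R}(z₀)`), its `ℤ^d` curl `daR`, its push `u0`, and the antisymmetrised Pauli read-out `F̂^α` of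
`F^α_p = Re tr((iσ_α)(V(∂p) − 1))`:
`|actionDeriv (fundamentalRep (Fin 2)) (fun b => (u0 b : ℂ) • (iσ_α)) V + ¼·Σ_{y∈Q_{3R+2}(z₀)}Σ_μΣ_ν daR y μ ν·F̂^α y μ ν|`
`≤ 14·(((d−1):ℕ)·n·θ)·θ·(4·(d−1)·Σ_{y∈Q_{3R}(z₀)}Σ_ν |ã y ν|)`.
[cite: GrossCMP1983, Thm 2.2] [cite: Balaban1985BackgroundPropagators, (3.7) p.391] -/
theorem sd_term_le (U : GaugeField P j (Matrix.specialUnitaryGroup (Fin 2) ℂ)) {lo hi : Fin P.d → ℤ} {θ : ℝ} {n : ℕ}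
    (hU : PlaqSmallOn (boxPlaqs lo hi) θ U) (hθ : 0 ≤ θ) (hn : ∀ κ, hi κ ≤ lo κ + n) (hnN : n < P.sitesPerDir j)
    (hN : ∀ κ, hi κ - lo κ < P.sitesPerDir j) (z₀ : Zd P.d) (R : ℕ)
    (hlo : ∀ κ, lo κ = z₀ κ - (3 * (R : ℤ) + 2)) (hhi : ∀ κ, hi κ = z₀ κ + (3 * (R : ℤ) + 4))
    (at' : Zd P.d → Fin P.d → ℝ) (χ : Zd P.d → ℝ) (aR : Zd P.d → Fin P.d → ℝ) (daR : Zd P.d → Fin P.d → Fin P.d → ℝ)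
    (hχ01 : ∀ x, 0 ≤ χ x ∧ χ x ≤ 1) (hχ0 : ∀ x, x ∉ box z₀ (3 * (R : ℤ)) → χ x = 0) (haR : ∀ x ν, aR x ν = χ x * at' x ν)
    (hdaR : ∀ x μ ν, daR x μ ν = (aR (x + unitVec μ) ν - aR x ν) - (aR (x + unitVec ν) μ - aR x μ))
    (u0 : PBond P j → ℝ)
    (hu0 : ∀ (x : Fin P.d → ℤ) (μ : Fin P.d), lo ≤ x → x + e μ ≤ hi → u0 ⟨castSite x, μ⟩ = aR x μ)
    (hu0off : ∀ b : PBond P j, (¬ ∃ y : Fin P.d → ℤ, lo ≤ y ∧ y + e b.dir ≤ hi ∧ b.src = castSite y) → u0 b = 0)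
    (α : Fin 3) (Fh : Zd P.d → Fin P.d → Fin P.d → ℝ)
    (hFh : ∀ z (μ ν : Fin P.d) (h : μ < ν), Fh z μ ν =
      ((I • pauli α) * (((GaugeField.plaqHol (GaugeField.gaugeAct (axialGauge U lo hi) U) ⟨castSite z, μ, ν, h⟩ :
        Matrix.specialUnitaryGroup (Fin 2) ℂ) : Matrix (Fin 2) (Fin 2) ℂ) - 1)).trace.re)
    (hFha : ∀ z μ ν, Fh z ν μ = -Fh z μ ν) :
    |actionDeriv (fundamentalRep (Fin 2)) (fun b => ((u0 b : ℝ) : ℂ) • (I • pauli α)) (GaugeField.gaugeAct (axialGauge U lo hi) U)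
        + (1 / 4) * ∑ y ∈ box z₀ (3 * (R : ℤ) + 2), ∑ μ : Fin P.d, ∑ ν : Fin P.d, daR y μ ν * Fh y μ ν|
      ≤ 14 * ((((P.d - 1 : ℕ) : ℝ) * n * θ)) * θ *
          (4 * ((P.d : ℝ) - 1) * ∑ y ∈ box z₀ (3 * (R : ℤ)), ∑ ν : Fin P.d, |at' y ν|) := by
  have haR1 := margin_of_cutoff z₀ R hlo hhi at' χ aR hχ0 haR
  have hsupp : ∀ b : PBond P j, u0 b ≠ 0 → ∃ x : Fin P.d → ℤ, lo + 1 ≤ x ∧ x + e b.dir + 1 ≤ hi ∧ b.src = castSite x :=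
    push_support_margin_of_margin1 aR haR1 u0 hu0 hu0off
  have h3 := abs_actionDeriv_dress_add_half_fluxPairing_le_norm1 U hU hθ hn hnN u0 α hsupp
  have hpair := sum_curl_push_mul_eq_half hN z₀ R hlo hhi at' χ aR daR hχ0 haR hdaR u0 hu0 hu0off
    (fun p => ((I • pauli α) * (((GaugeField.plaqHol (GaugeField.gaugeAct (axialGauge U lo hi) U) p :
      Matrix.specialUnitaryGroup (Fin 2) ℂ) : Matrix (Fin 2) (Fin 2) ℂ) - 1)).trace.re) Fh hFh hFha
  beta_reduce at hpair
  have herr := sum_abs_push_le_sum_abs_potential hN z₀ R hlo hhi at' χ aR hχ01 hχ0 haR u0 hu0 hu0off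
  have hquarter : (1 / 4 : ℝ) * ∑ y ∈ box z₀ (3 * (R : ℤ) + 2), ∑ μ : Fin P.d, ∑ ν : Fin P.d, daR y μ ν * Fh y μ ν =
      (1 / 2) * ∑ p : Plaq P j, (u0 (slotBond p 0) + u0 (slotBond p 1) - u0 (slotBond p 2) - u0 (slotBond p 3)) *
        ((I • pauli α) * (((GaugeField.plaqHol (GaugeField.gaugeAct (axialGauge U lo hi) U) p :
          Matrix.specialUnitaryGroup (Fin 2) ℂ) : Matrix (Fin 2) (Fin 2) ℂ) - 1)).trace.re := by
    rw [hpair]; ring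
  rw [hquarter]
  refine h3.trans ?_
  have hcoef : 0 ≤ 14 * ((((P.d - 1 : ℕ) : ℝ) * n * θ)) * θ := by positivity
  have hd1 : 0 ≤ 4 * ((P.d : ℝ) - 1) := by
    have : (1 : ℝ) ≤ P.d := by exact_mod_cast P.hd
    linarith
  exact mul_le_mul_of_nonneg_left (mul_le_mul_of_nonneg_left herr hd1) hcoef

end Summit.QuantumFields.YangMills.Theorems.GrossTransferStubLinTestSDTerm

end
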